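import Mathlib
import Summits.KontsevichZagierPeriods.Zeta5Search.BigPrimeNineSupport2
import Summits.KontsevichZagierPeriods.Zeta5Search.BigPrimeDual2
import HarnessLib

/-!
# `F̃₉(b)` below `b₀`, part 2: the two-level dual polynomial `M2` over `𝔽_p` (nine blocks)

Cell `pub-zeta5` (HONEST FRAMING: systematic search; no irrationality claim unless certified).  Provenance: written
by the family-designer seat `pub-zeta5-fam-vwp-g13` (planner role; staged for the cell's lane), FAMILY.md §21.
Nine-block port of the tree's `BigPrimeDual2.lean` (`k = 7`, typer gen 7).  Bookkeeping of OUR rational function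
`R̃_b`; nothing here concerns irrationality.

* `M2` (dual polynomial: the dropped slot polynomially, seven inner Wilson complements, the support complement,
  the two rim complements `KC`), the Wilson identity `P'^8 · ∏_{rim}(X+s) · M2 = num2 · (X^p − X)^{10}`
  (`pS_pow_mul_rim_mul_M2`);
* **`z2_cast`**: `z2_{q,i} ≡ e20(q)^8 · [X^{i+2}] M2(X − q) (mod p)` for `q ∈ S'`, `i < 8`, `i + 2 ≤ p` (shift by two:
  the two rim factors each contribute one `X`);
* `X_pow_eight_dvd_taylor_M2` (vanishing to order 8 off `S'`), `sum_univ_taylor_M2_coeff` (pole sum = full sum),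
  and the degree count `natDegree_M2_le`: `deg M2 + 8n + 7 ≤ 10p + 2Σβ_j`.
Validity: `p ≥ b₀ + 1 − β_{j₂} − β_{j₃}` (and `β_{j₂} ≤ β_{j₃} ≤` the seven inner `β_j`).  The generic pieces
(`KF`, `KC`, `pS`, `rimL/rimR`, `prod_mul_KC`, `cast_injOn_*`, …) are the tree's, imported.
-/

noncomputable section

open Finset Polynomial

namespace Summit.KontsevichZagierPeriods.Zeta5Search.BigPrimeNine

open Summit.KontsevichZagierPeriods.Zeta5Search.BigPrime (truncInv truncInv_spec truncInv_map
  coeff_eq_of_X_pow_dvd_sub taylor_prod' taylor_X_add_C block block_subset block_mono blockF KF rim rimL rimR KC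
  rim_eq_union rim_disjoint prod_mul_KC cast_injOn_Ico cast_injOn_Ioc pS cast_injOn_block pS_mul_KF taylor_pS
  taylor_X_pow_card_sub_X)

/-! ### The 𝔽_p side at level 2 (nine blocks) -/

section ModP2

variable {p : ℕ} [hp : Fact p.Prime]

variable (p) in
/-- The level-2 dual polynomial for nine blocks: block `j₁` entered polynomially, the seven inner blocks and the
support block by their Wilson complements `KF`, the two rim intervals by their complements `KC`. -/
def M2 (n : ℕ) (β : ℕ → ℕ) (j₁ j₂ j₃ : ℕ) : (ZMod p)[X] :=
  (C 2 * X + C (n : ZMod p)) * (∏ s ∈ range (n + 1) \ block n (β j₁), (X + C (s : ZMod p))) *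
    ((∏ j ∈ ((range 9).erase j₁).erase j₂, KF p n (β j)) * KF p n (β j₃) *
      (KC p (rimL (β j₂) (β j₃)) * KC p (rimR n (β j₂) (β j₃))))

/-- **Level-2 Wilson duality** (nine blocks): `P'^8 · ∏_{rim}(X+s) · M2 = num2 · (X^p − X)^{10}`,
`P' = ∏_{s∈S'}(X+s)`. -/
theorem pS_pow_mul_rim_mul_M2 {n : ℕ} {β : ℕ → ℕ} {j₁ j₂ j₃ : ℕ} (hj₁ : j₁ ∈ range 9) (hj₂ : j₂ ∈ (range 9).erase j₁)
    (hS : n + 1 ≤ p + 2 * β j₃) (hT : n + 1 ≤ p + β j₂ + β j₃) (h23 : β j₂ ≤ β j₃) (h3 : 2 * β j₃ ≤ n)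
    (hmin : ∀ j ∈ ((range 9).erase j₁).erase j₂, β j₃ ≤ β j) :
    pS p n β j₃ ^ 8 * (∏ s ∈ rim n (β j₂) (β j₃), (X + C (s : ZMod p))) * M2 p n β j₁ j₂ j₃ =
      num2 (ZMod p) n β j₁ j₂ j₃ * (X ^ p - X) ^ 10 := by
  -- seven inner blocks
  have hkey : pS p n β j₃ ^ 7 * ∏ j ∈ ((range 9).erase j₁).erase j₂, KF p n (β j) =
      (∏ j ∈ ((range 9).erase j₁).erase j₂, ∏ s ∈ block n (β j₃) \ block n (β j), (X + C (s : ZMod p))) *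
        (X ^ p - X) ^ 7 := by
    have h7 : pS p n β j₃ ^ 7 = ∏ _j ∈ ((range 9).erase j₁).erase j₂, pS p n β j₃ := by
      rw [prod_const, card_erase_of_mem hj₂, card_erase_of_mem hj₁, card_range]
    rw [h7, ← prod_mul_distrib, prod_congr rfl fun j hj => pS_mul_KF hS (block_mono (hmin j hj)), prod_mul_distrib,
      prod_const, card_erase_of_mem hj₂, card_erase_of_mem hj₁, card_range]
  -- the support block itself
  have hK3 : pS p n β j₃ * KF p n (β j₃) = X ^ p - X := by
    rw [pS_mul_KF hS (subset_refl _)]; simp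
  -- the two rim intervals
  have hrimprod : ∏ s ∈ rim n (β j₂) (β j₃), (X + C (s : ZMod p)) =
      (∏ s ∈ rimL (β j₂) (β j₃), (X + C (s : ZMod p))) * ∏ s ∈ rimR n (β j₂) (β j₃), (X + C (s : ZMod p)) := by
    rw [rim_eq_union h23 h3, prod_union (rim_disjoint h3)]
  have hL : (∏ s ∈ rimL (β j₂) (β j₃), (X + C (s : ZMod p))) * KC p (rimL (β j₂) (β j₃)) = X ^ p - X :=
    prod_mul_KC (cast_injOn_Ico (by omega))
  have hR : (∏ s ∈ rimR n (β j₂) (β j₃), (X + C (s : ZMod p))) * KC p (rimR n (β j₂) (β j₃)) = X ^ p - X :=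
    prod_mul_KC (cast_injOn_Ioc (by omega))
  rw [M2, num2, hrimprod]
  set P := pS p n β j₃
  set A := ∏ j ∈ ((range 9).erase j₁).erase j₂, KF p n (β j)
  set NA := ∏ j ∈ ((range 9).erase j₁).erase j₂, ∏ s ∈ block n (β j₃) \ block n (β j), (X + C (s : ZMod p))
  set QL := ∏ s ∈ rimL (β j₂) (β j₃), (X + C (s : ZMod p))
  set QR := ∏ s ∈ rimR n (β j₂) (β j₃), (X + C (s : ZMod p))
  set KL := KC p (rimL (β j₂) (β j₃))
  set KR := KC p (rimR n (β j₂) (β j₃))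
  set K3 := KF p n (β j₃)
  set L := C 2 * X + C (n : ZMod p)
  set P1 := ∏ s ∈ range (n + 1) \ block n (β j₁), (X + C (s : ZMod p))
  calc P ^ 8 * (QL * QR) * (L * P1 * (A * K3 * (KL * KR)))
      = L * P1 * (P ^ 7 * A) * (P * K3) * (QL * KL) * (QR * KR) := by ring
    _ = L * P1 * (NA * (X ^ p - X) ^ 7) * (X ^ p - X) * (X ^ p - X) * (X ^ p - X) := by rw [hkey, hK3, hL, hR]
    _ = L * P1 * NA * (X ^ p - X) ^ 10 := by ring

/-- **Level-2 shifted congruence** (nine blocks): for `q ∈ S'`, `i < 8` and `i + 2 ≤ p`,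
`z2_{q,i} ≡ e20(q)^8 · [X^{i+2}] M2(X − q) (mod p)`. -/
theorem z2_cast {n : ℕ} {β : ℕ → ℕ} {j₁ j₂ j₃ : ℕ} (hj₁ : j₁ ∈ range 9)
    (hj₂ : j₂ ∈ (range 9).erase j₁) (hS : n + 1 ≤ p + 2 * β j₃) (hT : n + 1 ≤ p + β j₂ + β j₃)
    (h23 : β j₂ ≤ β j₃) (h3 : 2 * β j₃ ≤ n) (hmin : ∀ j ∈ ((range 9).erase j₁).erase j₂, β j₃ ≤ β j)
    {q : ℕ} (hq : q ∈ block n (β j₃)) {i : ℕ} (hi : i < 8) (hip : i + 2 ≤ p) :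
    ((z2 n β j₁ j₂ j₃ q i : ℤ) : ZMod p) =
      ((e20 n β j₂ j₃ q : ℤ) : ZMod p) ^ 8 * (taylor (-((q : ℕ) : ZMod p)) (M2 p n β j₁ j₂ j₃)).coeff (i + 2) := by
  have hq' := hq
  rw [block, mem_Icc] at hq'
  set r : ZMod p := -((q : ℕ) : ZMod p) with hr
  set NF := taylor r (num2 (ZMod p) n β j₁ j₂ j₃) with hNF
  set EF := E2 (ZMod p) n β j₂ j₃ q with hEF
  set JF := truncInv EF 8 with hJF
  -- two factors X from the rim complements
  have hXL : (X : (ZMod p)[X]) ∣ taylor r (KC p (rimL (β j₂) (β j₃))) := by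
    have hmem : -r ∈ univ \ (rimL (β j₂) (β j₃)).image (Nat.cast : ℕ → ZMod p) := by
      rw [mem_sdiff]; refine ⟨mem_univ _, fun h => ?_⟩
      obtain ⟨s, hs, hsq⟩ := mem_image.1 h
      rw [rimL, mem_Ico] at hs
      rw [hr, neg_neg] at hsq
      have hm := (ZMod.natCast_eq_natCast_iff s q p).1 hsq
      have := hm.eq_of_abs_lt (by rw [abs_lt]; constructor <;> omega)
      omega
    rw [KC, taylor_prod']
    have hfac : taylor r (X + C (-r)) = X := by rw [taylor_X_add_C, neg_add_cancel, C_0, add_zero]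
    exact (dvd_of_eq hfac.symm).trans (Finset.dvd_prod_of_mem (fun u : ZMod p => taylor r (X + C u)) hmem)
  have hXR : (X : (ZMod p)[X]) ∣ taylor r (KC p (rimR n (β j₂) (β j₃))) := by
    have hmem : -r ∈ univ \ (rimR n (β j₂) (β j₃)).image (Nat.cast : ℕ → ZMod p) := by
      rw [mem_sdiff]; refine ⟨mem_univ _, fun h => ?_⟩
      obtain ⟨s, hs, hsq⟩ := mem_image.1 h
      rw [rimR, mem_Ioc] at hs
      rw [hr, neg_neg] at hsq
      have hm := (ZMod.natCast_eq_natCast_iff s q p).1 hsq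
      have := hm.eq_of_abs_lt (by rw [abs_lt]; constructor <;> omega)
      omega
    rw [KC, taylor_prod']
    have hfac : taylor r (X + C (-r)) = X := by rw [taylor_X_add_C, neg_add_cancel, C_0, add_zero]
    exact (dvd_of_eq hfac.symm).trans (Finset.dvd_prod_of_mem (fun u : ZMod p => taylor r (X + C u)) hmem)
  obtain ⟨ML, hML⟩ := hXL
  obtain ⟨MR, hMR⟩ := hXR
  -- M2(X − q) = X² · Mt
  set Mt := taylor r (C 2 * X + C (n : ZMod p)) * taylor r (∏ s ∈ range (n + 1) \ block n (β j₁), (X + C (s : ZMod p))) *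
    (taylor r (∏ j ∈ ((range 9).erase j₁).erase j₂, KF p n (β j)) * taylor r (KF p n (β j₃)) * (ML * MR)) with hMt
  have hM2 : taylor r (M2 p n β j₁ j₂ j₃) = X ^ 2 * Mt := by
    rw [M2, taylor_mul, taylor_mul, taylor_mul, taylor_mul, taylor_mul, hML, hMR, hMt]; ring
  -- shift the identity
  have hshift := congrArg (taylor r) (pS_pow_mul_rim_mul_M2 hj₁ hj₂ hS hT h23 h3 hmin)
  rw [taylor_mul, taylor_mul, taylor_pow, taylor_pS hq, taylor_mul, taylor_pow, taylor_X_pow_card_sub_X, hM2,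
    taylor_prod'] at hshift
  have hRim : ∏ s ∈ rim n (β j₂) (β j₃), taylor r (X + C (s : ZMod p)) =
      ∏ s ∈ rim n (β j₂) (β j₃), (X + C ((s : ZMod p) - q)) :=
    prod_congr rfl fun s _ => by rw [taylor_X_add_C, sub_eq_add_neg]
  rw [hRim] at hshift
  have hXp : (X ^ p - X : (ZMod p)[X]) = X * (X ^ (p - 1) - 1) := by
    have h : (X : (ZMod p)[X]) ^ p = X * X ^ (p - 1) := by
      rw [← pow_succ', Nat.sub_add_cancel hp.out.one_le]
    rw [h]; ring
  rw [hXp] at hshift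
  have hcancel : EF * Mt = NF * (X ^ (p - 1) - 1) ^ 10 := by
    have h10 : (X : (ZMod p)[X]) ^ 10 ≠ 0 := pow_ne_zero _ X_ne_zero
    apply mul_left_cancel₀ h10
    rw [hEF, E2, prod_pow, hNF]
    linear_combination hshift
  have hY : (X : (ZMod p)[X]) ^ (p - 1) ∣ (X ^ (p - 1) - 1) ^ 10 - 1 := by
    have := sub_dvd_pow_sub_pow (X ^ (p - 1) - 1 : (ZMod p)[X]) (-1) 10
    rw [sub_neg_eq_add, sub_add_cancel] at this
    refine this.trans (dvd_of_eq ?_)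
    ring
  have hN : (X : (ZMod p)[X]) ^ (i + 1) ∣ X ^ (p - 1) := pow_dvd_pow X (by omega)
  have hA : (X : (ZMod p)[X]) ^ (i + 1) ∣ EF * Mt - NF := by
    rw [hcancel, show NF * (X ^ (p - 1) - 1) ^ 10 - NF = NF * ((X ^ (p - 1) - 1) ^ 10 - 1) by ring]
    exact (hN.trans hY).mul_left _
  have hB : (X : (ZMod p)[X]) ^ (i + 1) ∣ (EF * JF - C (EF.coeff 0 ^ 8)) * Mt :=
    ((pow_dvd_pow X (by omega : i + 1 ≤ 8)).trans (truncInv_spec EF 8)).mul_right _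
  have hC : (X : (ZMod p)[X]) ^ (i + 1) ∣ NF * JF - C (EF.coeff 0 ^ 8) * Mt := by
    have : NF * JF - C (EF.coeff 0 ^ 8) * Mt = (EF * JF - C (EF.coeff 0 ^ 8)) * Mt - (EF * Mt - NF) * JF := by
      ring
    rw [this]
    exact dvd_sub hB (hA.mul_right _)
  have hcoeff := coeff_eq_of_X_pow_dvd_sub hC (Nat.lt_succ_self i)
  have he0 : EF.coeff 0 = ((e20 n β j₂ j₃ q : ℤ) : ZMod p) := by
    rw [hEF, ← E2_map (Int.castRingHom (ZMod p)), coeff_map, E2_coeff_zero]; simp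
  have hL : NF * JF = (taylor (-(q : ℤ)) (num2 ℤ n β j₁ j₂ j₃) * truncInv (E2 ℤ n β j₂ j₃ q) 8).map
      (Int.castRingHom (ZMod p)) := by
    rw [Polynomial.map_mul, BigPrime.map_taylor, num2_map, truncInv_map, E2_map]
    simp [hNF, hJF, hEF, hr]
  have hMt' : Mt.coeff i = (taylor r (M2 p n β j₁ j₂ j₃)).coeff (i + 2) := by
    rw [hM2, coeff_X_pow_mul]
  rw [hL, coeff_map, he0, coeff_C_mul, hMt'] at hcoeff
  have hz : ((z2 n β j₁ j₂ j₃ q i : ℤ) : ZMod p) = (Int.castRingHom (ZMod p))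
      ((taylor (-(q : ℤ)) (num2 ℤ n β j₁ j₂ j₃) * truncInv (E2 ℤ n β j₂ j₃ q) 8).coeff i) := by
    simp [z2]
  rw [hz, hcoeff]

/-- Off the support `S'`, `M2` vanishes to order `8` (seven inner complements and the support complement). -/
theorem X_pow_eight_dvd_taylor_M2 {n : ℕ} {β : ℕ → ℕ} {j₁ j₂ j₃ : ℕ} (hj₁ : j₁ ∈ range 9)
    (hj₂ : j₂ ∈ (range 9).erase j₁) (hmin : ∀ j ∈ ((range 9).erase j₁).erase j₂, β j₃ ≤ β j) (x : ZMod p)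
    (hx : x ∉ (block n (β j₃)).image fun q : ℕ => -((q : ℕ) : ZMod p)) :
    (X : (ZMod p)[X]) ^ 8 ∣ taylor x (M2 p n β j₁ j₂ j₃) := by
  have hKdvd : ∀ βj : ℕ, block n βj ⊆ block n (β j₃) → (X : (ZMod p)[X]) ∣ taylor x (KF p n βj) := by
    intro βj hsub
    have hmem : -x ∈ univ \ blockF p n βj := by
      rw [mem_sdiff]
      refine ⟨mem_univ _, fun h => hx ?_⟩
      rw [blockF, mem_image] at h
      obtain ⟨s, hs, hsx⟩ := h
      exact mem_image.2 ⟨s, hsub hs, by rw [hsx, neg_neg]⟩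
    rw [KF, taylor_prod']
    have hfac : taylor x (X + C (-x)) = X := by rw [taylor_X_add_C, neg_add_cancel, C_0, add_zero]
    exact (dvd_of_eq hfac.symm).trans (Finset.dvd_prod_of_mem (fun u : ZMod p => taylor x (X + C u)) hmem)
  have h7 : (X : (ZMod p)[X]) ^ 7 ∣ taylor x (∏ j ∈ ((range 9).erase j₁).erase j₂, KF p n (β j)) := by
    rw [taylor_prod', show (X : (ZMod p)[X]) ^ 7 = ∏ _j ∈ ((range 9).erase j₁).erase j₂, (X : (ZMod p)[X]) by
      rw [prod_const, card_erase_of_mem hj₂, card_erase_of_mem hj₁, card_range]]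
    exact Finset.prod_dvd_prod_of_dvd _ _ fun j hj => hKdvd (β j) (block_mono (hmin j hj))
  have h1 : (X : (ZMod p)[X]) ∣ taylor x (KF p n (β j₃)) := hKdvd (β j₃) (subset_refl _)
  rw [M2, taylor_mul, taylor_mul, taylor_mul, taylor_mul, show (X : (ZMod p)[X]) ^ 8 = X ^ 7 * X by ring]
  exact ((mul_dvd_mul h7 h1).mul_right _).mul_left _

/-- Pole sum over `S'` = full sum over `𝔽_p` (coefficients of index `< 8`). -/
theorem sum_univ_taylor_M2_coeff {n : ℕ} {β : ℕ → ℕ} {j₁ j₂ j₃ : ℕ} (hj₁ : j₁ ∈ range 9)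
    (hj₂ : j₂ ∈ (range 9).erase j₁) (hS : n + 1 ≤ p + 2 * β j₃)
    (hmin : ∀ j ∈ ((range 9).erase j₁).erase j₂, β j₃ ≤ β j) {k : ℕ} (hk : k < 8) :
    ∑ x : ZMod p, (taylor x (M2 p n β j₁ j₂ j₃)).coeff k =
      ∑ q ∈ block n (β j₃), (taylor (-((q : ℕ) : ZMod p)) (M2 p n β j₁ j₂ j₃)).coeff k := by
  have hinj : Set.InjOn (fun q : ℕ => -((q : ℕ) : ZMod p)) (block n (β j₃) : Finset ℕ) := by
    intro a ha c hc hac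
    exact cast_injOn_block hS ha hc (neg_inj.1 hac)
  have hzero : ∀ x ∈ (univ : Finset (ZMod p)),
      x ∉ (block n (β j₃)).image (fun q : ℕ => -((q : ℕ) : ZMod p)) → (taylor x (M2 p n β j₁ j₂ j₃)).coeff k = 0 :=
    fun x _ hx => (X_pow_dvd_iff.1 (X_pow_eight_dvd_taylor_M2 hj₁ hj₂ hmin x hx)) k hk
  rw [← sum_subset (subset_univ _) hzero, sum_image hinj]

/-- Degree count at level 2 (nine blocks): `deg M2 + 8n + 7 ≤ 10p + 2Σβ_j`. -/
theorem natDegree_M2_le {n : ℕ} {β : ℕ → ℕ} {j₁ j₂ j₃ : ℕ} (hj₁ : j₁ ∈ range 9) (hj₂ : j₂ ∈ (range 9).erase j₁)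
    (hS : n + 1 ≤ p + 2 * β j₃) (hT : n + 1 ≤ p + β j₂ + β j₃) (h23 : β j₂ ≤ β j₃)
    (hmin : ∀ j ∈ ((range 9).erase j₁).erase j₂, β j₃ ≤ β j) (hβ : ∀ j ∈ range 9, 2 * β j ≤ n)
    (hj₃ : 2 * β j₃ ≤ n) :
    (M2 p n β j₁ j₂ j₃).natDegree + 8 * n + 7 ≤ 10 * p + 2 * ∑ j ∈ range 9, β j := by
  have hlin : (C (2 : ZMod p) * X + C (n : ZMod p)).natDegree ≤ 1 := by
    refine (natDegree_add_le _ _).trans (max_le ?_ (by simp))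
    exact (natDegree_C_mul_le _ _).trans natDegree_X_le
  have hmid : (∏ s ∈ range (n + 1) \ block n (β j₁), (X + C (s : ZMod p))).natDegree ≤ 2 * β j₁ := by
    refine (natDegree_prod_le _ _).trans ?_
    have hcard : #(range (n + 1) \ block n (β j₁)) = 2 * β j₁ := by
      have h1 := card_sdiff_add_card_eq_card (block_subset n (β j₁))
      rw [block, Nat.card_Icc, card_range] at h1
      have := hβ j₁ hj₁
      rw [block]
      omega
    simp only [natDegree_X_add_C, sum_const, smul_eq_mul, mul_one, hcard, le_refl]
  -- every KF with block inside S'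
  have hKbd : ∀ βj : ℕ, 2 * βj ≤ n → β j₃ ≤ βj →
      (KF p n βj).natDegree + (n + 1) ≤ p + 2 * βj := by
    intro βj hb h3j
    have hsub : block n βj ⊆ block n (β j₃) := block_mono h3j
    have hcard : #(blockF p n βj) = (n - βj) + 1 - βj := by
      rw [blockF, card_image_of_injOn ((cast_injOn_block hS).mono (by exact_mod_cast hsub)), block, Nat.card_Icc]
    have hdeg : (KF p n βj).natDegree ≤ p - #(blockF p n βj) := by
      rw [KF]
      refine (natDegree_prod_le _ _).trans ?_
      simp only [natDegree_X_add_C, sum_const, card_univ_sdiff, ZMod.card, smul_eq_mul, mul_one, le_refl]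
    rw [hcard] at hdeg
    have : (n - βj) + 1 - βj ≤ n + 1 := by omega
    omega
  have hK : ∀ j ∈ ((range 9).erase j₁).erase j₂, (KF p n (β j)).natDegree + (n + 1) ≤ p + 2 * β j := by
    intro j hj
    have hj9 : j ∈ range 9 := (mem_erase.1 (mem_erase.1 hj).2).2
    exact hKbd (β j) (hβ j hj9) (hmin j hj)
  have hK3 : (KF p n (β j₃)).natDegree + (n + 1) ≤ p + 2 * β j₃ := hKbd (β j₃) hj₃ le_rfl
  -- rim complements
  have hKC : ∀ T : Finset ℕ, Set.InjOn (Nat.cast : ℕ → ZMod p) (T : Set ℕ) → (KC p T).natDegree + #T ≤ p := by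
    intro T hinj
    have hdeg : (KC p T).natDegree ≤ p - #(T.image (Nat.cast : ℕ → ZMod p)) := by
      rw [KC]
      refine (natDegree_prod_le _ _).trans ?_
      simp only [natDegree_X_add_C, sum_const, card_univ_sdiff, ZMod.card, smul_eq_mul, mul_one, le_refl]
    rw [card_image_of_injOn hinj] at hdeg
    have : #T ≤ p := by
      rw [← card_image_of_injOn hinj]
      exact (card_le_univ _).trans (ZMod.card p).le
    omega
  have hKL := hKC _ (cast_injOn_Ico (a := β j₂) (c := β j₃) (by omega))
  have hKR := hKC _ (cast_injOn_Ioc (a := n - β j₃) (c := n - β j₂) (by omega))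
  simp only [Nat.card_Ico] at hKL
  simp only [Nat.card_Ioc] at hKR
  have hKL' : (KC p (rimL (β j₂) (β j₃))).natDegree + (β j₃ - β j₂) ≤ p := hKL
  have hKR' : (KC p (rimR n (β j₂) (β j₃))).natDegree + (n - β j₂ - (n - β j₃)) ≤ p := hKR
  have hKsum := sum_le_sum hK
  simp only [sum_add_distrib, sum_const, card_erase_of_mem hj₂, card_erase_of_mem hj₁, card_range, smul_eq_mul] at hKsum
  have hprod : (∏ j ∈ ((range 9).erase j₁).erase j₂, KF p n (β j)).natDegree ≤
      ∑ j ∈ ((range 9).erase j₁).erase j₂, (KF p n (β j)).natDegree := natDegree_prod_le _ _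
  have hM2 : (M2 p n β j₁ j₂ j₃).natDegree ≤ 1 + 2 * β j₁ +
      ((∑ j ∈ ((range 9).erase j₁).erase j₂, (KF p n (β j)).natDegree) + (KF p n (β j₃)).natDegree +
        ((KC p (rimL (β j₂) (β j₃))).natDegree + (KC p (rimR n (β j₂) (β j₃))).natDegree)) := by
    rw [M2]
    refine natDegree_mul_le.trans (add_le_add (natDegree_mul_le.trans (add_le_add hlin hmid)) ?_)
    refine natDegree_mul_le.trans (add_le_add (natDegree_mul_le.trans (add_le_add hprod le_rfl)) natDegree_mul_le)
  have h2 : ∑ j ∈ ((range 9).erase j₁).erase j₂, 2 * β j = 2 * ∑ j ∈ ((range 9).erase j₁).erase j₂, β j :=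
    (mul_sum _ _ _).symm
  have h3 : ∑ j ∈ ((range 9).erase j₁).erase j₂, β j + β j₂ + β j₁ = ∑ j ∈ range 9, β j := by
    rw [sum_erase_add _ _ hj₂, sum_erase_add _ _ hj₁]
  omega

end ModP2

end Summit.KontsevichZagierPeriods.Zeta5Search.BigPrimeNine

end
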